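import Literature.NumberTheory.Sieve.FouvryTenenbaumDivisorAP
import Literature.NumberTheory.Sieve.RoughNumbersCoprimeProgressions
import Mathlib.Data.Fin.Tuple.Finset
import HarnessLib

/-!
# Fouvry–Tenenbaum 2021, Lemmas 4.12–4.13 in tuple form, and the one-variable count

Topic `Literature/NumberTheory/Sieve`; theorems (and two bookkeeping definitions), everything PROVED.
É. Fouvry, G. Tenenbaum, Trans. AMS 375 (2022) 245–299 (doi:10.1090/tran/8442), Lemmas 4.12 (4.16) and
4.13 (4.18), are vendored in `Literature.NumberTheory.Sieve.FouvryTenenbaumDivisorAP` as the named facts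
`FouvryTenenbaum2021_lemma412/413` (`τ₂`, `τ₃` in arithmetic progressions beyond `√x`, unit classes `mod D`
on each variable, arbitrary sub-intervals of dyadic boxes, bound `C D^{C₀} x^{1−δ}/φ(s)`).  Consumers that
organise the variables of a combinatorial decomposition (Heath-Brown's identity) as TUPLES need the same
statements with the "initial" variables indexed by `Fin k` and one distinguished last variable:

* `apBox lo hi D t = {⌊lo⌋ < m ≤ ⌊hi⌋ : m ≡ t (mod D)}` — the one-variable range of (4.16)/(4.18);
* `DivisorAPTuple k θ` — the tuple form with `k` initial variables and level `s ≤ x^θ`;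
* `divisorAPTuple_mono` — lowering the level exponent;
* `divisorAPTuple_one` — `k = 1`, `θ = 3/5`, from Lemma 4.12; `divisorAPTuple_two` — `k = 2`,
  `θ = 1/2 + 1/85`, from Lemma 4.13 (pure re-indexing `Fin 1 → ℕ ≃ ℕ`, `Fin 2 → ℕ ≃ ℕ × ℕ`);
* `divisorAPTuple_zero` — `k = 0` (ONE variable), any `θ ≤ 4/5`, PROVED unconditionally by counting:
  `|∑_{n ∈ I, n ≡ t (D)} g_s(n; a)| ≤ 1 + τ(s)/φ(s)` (Chinese remainder theorem for the class `mod Ds`, Möbius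
  inversion of `(n, s) = 1`, `∑_{e ∣ s} μ(e)/e = φ(s)/s`), and `φ(s) + τ(s) ≤ 2s ≤ 2x^{4/5}`.

## References

* É. Fouvry, G. Tenenbaum, Trans. Amer. Math. Soc. 375 (2022), Lemmas 4.12–4.13. [FouvryTenenbaum2021]
-/

open Finset Fintype Real
open scoped ArithmeticFunction.Moebius ArithmeticFunction.sigma

noncomputable section

namespace Literature.NumberTheory.Sieve

namespace FouvryTenenbaum2021

/-! ### Vocabulary -/

/-- The one-variable range of (4.16)/(4.18): `{⌊lo⌋ < m ≤ ⌊hi⌋ : m ≡ t (mod D)}` ("`m ≃ M`, `m ≡ t (mod D)`",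
an arbitrary sub-interval of `]M, 2M]` in a unit class). [cite: FouvryTenenbaum2021, Lemma 4.12] -/
def apBox (lo hi : ℝ) (D : ℕ) (t : ℤ) : Finset ℕ :=
  (Ioc ⌊lo⌋₊ ⌊hi⌋₊).filter (fun m : ℕ => (m : ZMod D) = (t : ZMod D))

/-- **Tuple form of Fouvry–Tenenbaum's Lemmas 4.12/4.13** with `k` initial variables (box scales
`M : Fin k → ℝ`, increasing) and one last variable (scale `Ml ≥ M i`), level `s ≤ x^θ`:
`|∑_{m⃗, n} g_s((∏ mᵢ) n; a)| ≤ C D^{C₀} x^{1−δ}/φ(s)` over `mᵢ ∈ apBox (lo i) (hi i) D (t i)`,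
`n ∈ apBox lol hil D tl`, with `x^{1/100} ≤ M i ≤ lo i`, `hi i ≤ 2 M i`, `(∏ M i) Ml ≤ x`, unit classes.
[cite: FouvryTenenbaum2021, Lemmas 4.12–4.13] -/
def DivisorAPTuple (k : ℕ) (θ : ℝ) : Prop :=
  ∃ δ C₀ C : ℝ, 0 < δ ∧ 0 ≤ C₀ ∧ 0 ≤ C ∧ ∀ x : ℝ, 1 ≤ x →
    ∀ (M lo hi : Fin k → ℝ) (Ml lol hil : ℝ),
      Monotone M → (∀ i, M i ≤ Ml) → (∀ i, x ^ (1 / 100 : ℝ) ≤ M i) → x ^ (1 / 100 : ℝ) ≤ Ml →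
      (∏ i, M i) * Ml ≤ x →
      (∀ i, M i ≤ lo i) → (∀ i, hi i ≤ 2 * M i) → Ml ≤ lol → hil ≤ 2 * Ml →
    ∀ (s D : ℕ) (a : ℤ) (t : Fin k → ℤ) (tl : ℤ), 1 ≤ s → (s : ℝ) ≤ x ^ θ → 1 ≤ D →
      IsCoprime (s : ℤ) (a * D) → (∀ i, IsCoprime (t i) (D : ℤ)) → IsCoprime tl (D : ℤ) →
      |∑ m ∈ piFinset (fun i => apBox (lo i) (hi i) D (t i)), ∑ n ∈ apBox lol hil D tl,
          gAP s a ((∏ i, m i) * n)| ≤ C * (D : ℝ) ^ C₀ * x ^ (1 - δ) / (Nat.totient s : ℝ)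

/-- Lowering the level exponent. [folklore] -/
theorem divisorAPTuple_mono {k : ℕ} {θ θ' : ℝ} (h : DivisorAPTuple k θ) (hθ : θ' ≤ θ) :
    DivisorAPTuple k θ' := by
  obtain ⟨δ, C₀, C, hδ, hC₀, hC, H⟩ := h
  refine ⟨δ, C₀, C, hδ, hC₀, hC, fun x hx M lo hi Ml lol hil h1 h2 h3 h4 h5 h6 h7 h8 h9
    s D a t tl hs hsx hD hsa ht htl => ?_⟩
  exact H x hx M lo hi Ml lol hil h1 h2 h3 h4 h5 h6 h7 h8 h9 s D a t tl hs
    (hsx.trans (Real.rpow_le_rpow_of_exponent_le hx hθ)) hD hsa ht htl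

/-- Replacing the constants `C₀, C` of Lemma 4.12/4.13 by `max C₀ 0`, `max C 0`. [folklore] -/
theorem bound_mono {C C₀ δ x : ℝ} {D s : ℕ} (hD : 1 ≤ D) (hx : 0 ≤ x) :
    C * (D : ℝ) ^ C₀ * x ^ (1 - δ) / (Nat.totient s : ℝ) ≤
      max C 0 * (D : ℝ) ^ (max C₀ 0) * x ^ (1 - δ) / (Nat.totient s : ℝ) := by
  have hD' : (1 : ℝ) ≤ D := by exact_mod_cast hD
  have h1 : (D : ℝ) ^ C₀ ≤ (D : ℝ) ^ (max C₀ 0) := Real.rpow_le_rpow_of_exponent_le hD' (le_max_left _ _)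
  have h2 : 0 ≤ (D : ℝ) ^ C₀ := by positivity
  have h3 : 0 ≤ x ^ (1 - δ) / (Nat.totient s : ℝ) := by positivity
  rw [mul_div_assoc, mul_div_assoc]
  calc C * (D : ℝ) ^ C₀ * (x ^ (1 - δ) / (Nat.totient s : ℝ))
      ≤ max C 0 * (D : ℝ) ^ C₀ * (x ^ (1 - δ) / (Nat.totient s : ℝ)) := by
        gcongr
        exact le_max_left _ _
    _ ≤ max C 0 * (D : ℝ) ^ (max C₀ 0) * (x ^ (1 - δ) / (Nat.totient s : ℝ)) := by
        gcongr

/-! ### `k = 1` from Lemma 4.12 and `k = 2` from Lemma 4.13 -/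

/-- **Lemma 4.12 in tuple form** (`k = 1`, level `x^{3/5}`). [cite: FouvryTenenbaum2021, Lemma 4.12] -/
theorem divisorAPTuple_one (h : FouvryTenenbaum2021_lemma412) : DivisorAPTuple 1 (3 / 5) := by
  obtain ⟨δ, C₀, C, hδ, H⟩ := h
  refine ⟨δ, max C₀ 0, max C 0, hδ, le_max_right _ _, le_max_right _ _,
    fun x hx M lo hi Ml lol hil _ hMl hM1 _ hprod hlo hhi hlol hhil s D a t tl hs hsx hD hsa ht htl => ?_⟩
  have hx0 : 0 ≤ x := by linarith
  have hprod' : M 0 * Ml ≤ x := by rwa [Fin.prod_univ_one] at hprod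
  have key := H x hx (M 0) Ml (lo 0) (hi 0) lol hil (hM1 0) (hMl 0) hprod' (hlo 0) (hhi 0) hlol hhil
    s D a (t 0) tl hs hsx hD hsa ((ht 0).mul_left htl)
  -- re-index `Fin 1 → ℕ ≃ ℕ`
  have hsum : ∑ m ∈ piFinset (fun i => apBox (lo i) (hi i) D (t i)), ∑ n ∈ apBox lol hil D tl,
        gAP s a ((∏ i, m i) * n) =
      ∑ m₁ ∈ apBox (lo 0) (hi 0) D (t 0), ∑ n ∈ apBox lol hil D tl, gAP s a (m₁ * n) := by
    refine Finset.sum_equiv (Equiv.funUnique (Fin 1) ℕ) (fun m => ?_) (fun m _ => ?_)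
    · simp only [Fintype.mem_piFinset, Equiv.funUnique_apply, Fin.forall_fin_one, Fin.default_eq_zero]
    · simp
  rw [hsum]
  exact key.trans (bound_mono hD hx0)

/-- **Lemma 4.13 in tuple form** (`k = 2`, level `x^{1/2+1/85}`). [cite: FouvryTenenbaum2021, Lemma 4.13] -/
theorem divisorAPTuple_two (h : FouvryTenenbaum2021_lemma413) : DivisorAPTuple 2 (1 / 2 + 1 / 85) := by
  obtain ⟨δ, C₀, C, hδ, H⟩ := h
  refine ⟨δ, max C₀ 0, max C 0, hδ, le_max_right _ _, le_max_right _ _,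
    fun x hx M lo hi Ml lol hil hM hMl hM1 _ hprod hlo hhi hlol hhil s D a t tl hs hsx hD hsa ht htl => ?_⟩
  have hx0 : 0 ≤ x := by linarith
  have hprod' : M 0 * M 1 * Ml ≤ x := by rwa [Fin.prod_univ_two] at hprod
  have h01 : M 0 ≤ M 1 := hM (by decide)
  have key := H x hx (M 0) (M 1) Ml (lo 0) (hi 0) (lo 1) (hi 1) lol hil (hM1 0) h01 (hMl 1) hprod'
    (hlo 0) (hhi 0) (hlo 1) (hhi 1) hlol hhil s D a (t 0) (t 1) tl hs hsx hD hsa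
    (((ht 0).mul_left (ht 1)).mul_left htl)
  have hsum : ∑ m ∈ piFinset (fun i => apBox (lo i) (hi i) D (t i)), ∑ n ∈ apBox lol hil D tl,
        gAP s a ((∏ i, m i) * n) =
      ∑ m₁ ∈ apBox (lo 0) (hi 0) D (t 0), ∑ m₂ ∈ apBox (lo 1) (hi 1) D (t 1),
        ∑ n ∈ apBox lol hil D tl, gAP s a (m₁ * m₂ * n) := by
    rw [← Finset.sum_product' (s := apBox (lo 0) (hi 0) D (t 0)) (t := apBox (lo 1) (hi 1) D (t 1))
      (f := fun m₁ m₂ => ∑ n ∈ apBox lol hil D tl, gAP s a (m₁ * m₂ * n))]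
    refine Finset.sum_equiv (finTwoArrowEquiv ℕ) (fun m => ?_) (fun m _ => ?_)
    · simp only [Fintype.mem_piFinset, Fin.forall_fin_two, Finset.mem_product]
      rfl
    · simp [Fin.prod_univ_two]
  rw [hsum]
  exact key.trans (bound_mono hD hx0)

/-! ### `k = 0`: one variable, by counting -/

/-- `[(n, s) = 1] = ∑_{e ∣ s} μ(e) [e ∣ n]` for `s ≠ 0` (real weights). [folklore] -/
theorem ite_coprime_eq_sum_divisors_real {s : ℕ} (hs : s ≠ 0) (n : ℕ) :
    (if n.Coprime s then (1 : ℝ) else 0) = ∑ e ∈ s.divisors, if e ∣ n then (μ e : ℝ) else 0 := by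
  -- adapted from Literature/NumberTheory/Sieve/Polymath8aSmoothSiegelWalfisz.lean
  have hset : s.divisors.filter (fun e => e ∣ n) = (Nat.gcd n s).divisors := by
    ext e
    simp only [Finset.mem_filter, Nat.mem_divisors, Nat.dvd_gcd_iff]
    constructor
    · rintro ⟨⟨h1, -⟩, h2⟩
      exact ⟨⟨h2, h1⟩, fun h => hs (Nat.eq_zero_of_gcd_eq_zero_right h)⟩
    · rintro ⟨⟨h2, h1⟩, -⟩
      exact ⟨⟨h1, hs⟩, h2⟩
  have hμ : ∑ d ∈ (Nat.gcd n s).divisors, (μ d : ℝ) = if Nat.gcd n s = 1 then 1 else 0 := by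
    have h := congrArg (fun F : ArithmeticFunction ℝ => F (Nat.gcd n s))
      (ArithmeticFunction.coe_moebius_mul_coe_zeta (R := ℝ))
    simp only [ArithmeticFunction.coe_mul_zeta_apply, ArithmeticFunction.intCoe_apply,
      ArithmeticFunction.one_apply] at h
    exact h
  rw [← Finset.sum_filter, hset, hμ]

/-- `∑_{e ∣ s} μ(e)/e = φ(s)/s` for `s ≥ 1` (`φ = μ ⋆ id`). [folklore] -/
theorem sum_divisors_moebius_div_real {s : ℕ} (hs : 0 < s) :
    ∑ e ∈ s.divisors, (μ e : ℝ) / e = (Nat.totient s : ℝ) / s := by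
  -- adapted from Literature/NumberTheory/Sieve/BombieriFriedlanderIwaniecTheorem5Poisson.lean
  have key : ∀ n > 0, ∑ x ∈ n.divisorsAntidiagonal, (μ x.fst : ℤ) • ((x.snd : ℕ) : ℤ) =
      (Nat.totient n : ℤ) := by
    refine (ArithmeticFunction.sum_eq_iff_sum_smul_moebius_eq (R := ℤ)
      (f := fun n => (Nat.totient n : ℤ)) (g := fun n => ((n : ℕ) : ℤ))).mp ?_
    intro n _
    exact_mod_cast Nat.sum_totient n
  have h := key s hs
  rw [Nat.sum_divisorsAntidiagonal (f := fun a b => (μ a : ℤ) • ((b : ℕ) : ℤ))] at h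
  have h' := congrArg (fun z : ℤ => (z : ℝ) / s) h
  simp only [zsmul_eq_mul, Int.cast_id, Int.cast_sum, Int.cast_mul, Int.cast_natCast, Finset.sum_div] at h'
  rw [← h']
  refine Finset.sum_congr rfl fun d hd => ?_
  have hdk : d ∣ s := Nat.dvd_of_mem_divisors hd
  have hd0 : (d : ℝ) ≠ 0 := by exact_mod_cast (Nat.pos_of_mem_divisors hd).ne'
  have hk0 : (s : ℝ) ≠ 0 := by exact_mod_cast hs.ne'
  rw [Nat.cast_div hdk hd0]
  field_simp

/-- **The one-variable count**: for `s, D ≥ 1`, `(D, s) = 1`, every interval `(A, B]` and classes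
`t mod D`, `a mod s`: `|∑_{A < n ≤ B, n ≡ t (D)} g_s(n; a)| ≤ 1 + τ(s)/φ(s)` (the main terms
`(B−A)/(Ds)` of the class `n ≡ a (s)` and of `φ(s)⁻¹ #{(n, s) = 1}` cancel). [folklore] -/
theorem abs_sum_apBox_gAP_le {s D : ℕ} (hs : 0 < s) (hD : 0 < D) (hDs : D.Coprime s) (a t : ℤ) (A B : ℕ) :
    |∑ n ∈ (Ioc A B).filter (fun m : ℕ => (m : ZMod D) = (t : ZMod D)), gAP s a n| ≤
      1 + (σ 0 s : ℝ) / (Nat.totient s : ℝ) := by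
  haveI : NeZero D := ⟨hD.ne'⟩
  haveI : NeZero s := ⟨hs.ne'⟩
  have hφ : (0 : ℝ) < Nat.totient s := by exact_mod_cast Nat.totient_pos.2 hs
  have hτφ : 0 ≤ (σ 0 s : ℝ) / (Nat.totient s : ℝ) := by positivity
  rcases lt_or_ge B A with hBA | hAB
  · rw [Finset.Ioc_eq_empty (by omega), Finset.filter_empty, Finset.sum_empty, abs_zero]
    linarith
  -- natural representatives of the classes
  set t' : ℕ := (t : ZMod D).val with ht'
  set a' : ℕ := (a : ZMod s).val with ha'
  have hclassD : ∀ n : ℕ, ((n : ZMod D) = (t : ZMod D)) ↔ n ≡ t' [MOD D] := fun n => by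
    rw [← ZMod.natCast_eq_natCast_iff, ht', ZMod.natCast_zmod_val]
  have hclassS : ∀ n : ℕ, ((n : ZMod s) = (a : ZMod s)) ↔ n ≡ a' [MOD s] := fun n => by
    rw [← ZMod.natCast_eq_natCast_iff, ha', ZMod.natCast_zmod_val]
  set AP := (Ioc A B).filter (fun m : ℕ => (m : ZMod D) = (t : ZMod D)) with hAP
  -- the two counts
  have hsplit : ∑ n ∈ AP, gAP s a n =
      ((AP.filter (fun n : ℕ => (n : ZMod s) = (a : ZMod s))).card : ℝ) -
        ((AP.filter (fun n : ℕ => n.Coprime s)).card : ℝ) / (Nat.totient s : ℝ) := by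
    simp only [gAP, Finset.sum_sub_distrib, ← Finset.sum_div]
    congr 1
    · rw [Finset.sum_boole]
    · rw [Finset.sum_boole]
  -- N₁ : one class mod `D s`
  set c₁ : ℕ := (Nat.chineseRemainder hDs t' a' : ℕ) with hc₁
  have hN₁set : AP.filter (fun n : ℕ => (n : ZMod s) = (a : ZMod s)) =
      (Ioc A B).filter (fun n : ℕ => n ≡ c₁ [MOD D * s]) := by
    rw [hAP, Finset.filter_filter]
    refine Finset.filter_congr fun n _ => ?_
    have hc := (Nat.chineseRemainder hDs t' a').prop
    rw [hclassD, hclassS, ← Nat.modEq_and_modEq_iff_modEq_mul hDs]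
    constructor
    · rintro ⟨h1, h2⟩; exact ⟨h1.trans hc.1.symm, h2.trans hc.2.symm⟩
    · rintro ⟨h1, h2⟩; exact ⟨h1.trans hc.1, h2.trans hc.2⟩
  have hN₁ := BFI.abs_card_Ioc_filter_modEq_sub_le (Nat.mul_pos hD hs) c₁ hAB
  rw [← hN₁set] at hN₁
  -- N₂ : Möbius
  have hN₂ : ((AP.filter (fun n : ℕ => n.Coprime s)).card : ℝ) =
      ∑ e ∈ s.divisors, (μ e : ℝ) * (((Ioc A B).filter (fun n : ℕ => n ≡ t' [MOD D] ∧ e ∣ n)).card : ℝ) := by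
    have h1 : ((AP.filter (fun n : ℕ => n.Coprime s)).card : ℝ) =
        ∑ n ∈ AP, if n.Coprime s then (1 : ℝ) else 0 := by
      rw [Finset.sum_boole]
    rw [h1, Finset.sum_congr rfl (fun n _ => ite_coprime_eq_sum_divisors_real hs.ne' n), Finset.sum_comm]
    refine Finset.sum_congr rfl fun e _ => ?_
    have h2 : (((Ioc A B).filter (fun n : ℕ => n ≡ t' [MOD D] ∧ e ∣ n)).card : ℝ) =
        ∑ n ∈ AP, if e ∣ n then (1 : ℝ) else 0 := by
      rw [Finset.sum_boole, hAP, Finset.filter_filter]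
      congr 2
      exact Finset.filter_congr fun n _ => by rw [hclassD]
    rw [h2, Finset.mul_sum]
    exact Finset.sum_congr rfl fun n _ => by split_ifs <;> simp
  -- each divisor class count
  have hNe : ∀ e ∈ s.divisors,
      |(((Ioc A B).filter (fun n : ℕ => n ≡ t' [MOD D] ∧ e ∣ n)).card : ℝ) - ((B : ℝ) - A) / (D * e)| ≤ 1 := by
    intro e he
    have he0 : 0 < e := Nat.pos_of_mem_divisors he
    have hDe : D.Coprime e := Nat.Coprime.coprime_dvd_right (Nat.dvd_of_mem_divisors he) hDs
    rw [BFI.filter_modEq_and_dvd_eq hDe]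
    have := BFI.abs_card_Ioc_filter_modEq_sub_le (Nat.mul_pos hD he0)
      (Nat.chineseRemainder hDe t' 0 : ℕ) hAB
    push_cast at this
    exact this
  -- assemble
  rw [hsplit, hN₂]
  set N₁ : ℝ := ((AP.filter (fun n : ℕ => (n : ZMod s) = (a : ZMod s))).card : ℝ) with hN₁def
  set X : ℝ := (B : ℝ) - A with hX
  have hmain : ∑ e ∈ s.divisors, (μ e : ℝ) * (X / (D * e)) = X * (Nat.totient s : ℝ) / (D * s) := by
    have h1 : ∀ e ∈ s.divisors, (μ e : ℝ) * (X / (D * e)) = X / D * ((μ e : ℝ) / e) := by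
      intro e he
      have he0 : (e : ℝ) ≠ 0 := by exact_mod_cast (Nat.pos_of_mem_divisors he).ne'
      have hD0 : (D : ℝ) ≠ 0 := by exact_mod_cast hD.ne'
      field_simp
    rw [Finset.sum_congr rfl h1, ← Finset.mul_sum, sum_divisors_moebius_div_real hs]
    have hD0 : (D : ℝ) ≠ 0 := by exact_mod_cast hD.ne'
    have hs0 : (s : ℝ) ≠ 0 := by exact_mod_cast hs.ne'
    field_simp
  -- error terms
  have herr : |∑ e ∈ s.divisors, (μ e : ℝ) *
      ((((Ioc A B).filter (fun n : ℕ => n ≡ t' [MOD D] ∧ e ∣ n)).card : ℝ) - X / (D * e))| ≤ (σ 0 s : ℝ) := by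
    calc _ ≤ ∑ e ∈ s.divisors, |(μ e : ℝ) *
          ((((Ioc A B).filter (fun n : ℕ => n ≡ t' [MOD D] ∧ e ∣ n)).card : ℝ) - X / (D * e))| :=
          Finset.abs_sum_le_sum_abs _ _
      _ ≤ ∑ e ∈ s.divisors, (1 : ℝ) := by
          refine Finset.sum_le_sum fun e he => ?_
          rw [abs_mul]
          have hμ1 : |(μ e : ℝ)| ≤ 1 := by exact_mod_cast ArithmeticFunction.abs_moebius_le_one
          exact mul_le_one₀ hμ1 (abs_nonneg _) (hNe e he)
      _ = (σ 0 s : ℝ) := by simp [ArithmeticFunction.sigma_zero_apply]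
  have hdecomp : ∑ e ∈ s.divisors, (μ e : ℝ) *
        (((Ioc A B).filter (fun n : ℕ => n ≡ t' [MOD D] ∧ e ∣ n)).card : ℝ) =
      X * (Nat.totient s : ℝ) / (D * s) + ∑ e ∈ s.divisors, (μ e : ℝ) *
        ((((Ioc A B).filter (fun n : ℕ => n ≡ t' [MOD D] ∧ e ∣ n)).card : ℝ) - X / (D * e)) := by
    rw [← hmain, ← Finset.sum_add_distrib]
    exact Finset.sum_congr rfl fun e _ => by ring
  rw [hdecomp]
  set E : ℝ := ∑ e ∈ s.divisors, (μ e : ℝ) *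
    ((((Ioc A B).filter (fun n : ℕ => n ≡ t' [MOD D] ∧ e ∣ n)).card : ℝ) - X / (D * e)) with hE
  have hD0 : (D : ℝ) ≠ 0 := by exact_mod_cast hD.ne'
  have hs0 : (s : ℝ) ≠ 0 := by exact_mod_cast hs.ne'
  have hsimp : N₁ - (X * (Nat.totient s : ℝ) / (D * s) + E) / (Nat.totient s : ℝ) =
      (N₁ - X / (D * s)) - E / (Nat.totient s : ℝ) := by
    field_simp
    ring
  rw [hsimp]
  have h1 : |N₁ - X / (D * s)| ≤ 1 := by
    have := hN₁; push_cast at this; rw [hX]; exact this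
  have h2 : |E / (Nat.totient s : ℝ)| ≤ (σ 0 s : ℝ) / (Nat.totient s : ℝ) := by
    rw [abs_div, abs_of_pos hφ]
    exact div_le_div_of_nonneg_right herr hφ.le
  calc |N₁ - X / (D * s) - E / (Nat.totient s : ℝ)|
      ≤ |N₁ - X / (D * s)| + |E / (Nat.totient s : ℝ)| := abs_sub _ _
    _ ≤ 1 + (σ 0 s : ℝ) / (Nat.totient s : ℝ) := add_le_add h1 h2

/-- **The one-variable case of the tuple form** (`k = 0`), unconditionally, for any level exponent
`θ ≤ 4/5`, with `δ = 1/5`, `C₀ = 0`, `C = 2`: `(1 + τ(s)/φ(s)) φ(s) = φ(s) + τ(s) ≤ 2s ≤ 2 x^{4/5}`. [folklore] -/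
theorem divisorAPTuple_zero {θ : ℝ} (hθ : θ ≤ 4 / 5) : DivisorAPTuple 0 θ := by
  refine ⟨1 / 5, 0, 2, by norm_num, le_rfl, by norm_num,
    fun x hx M lo hi Ml lol hil _ _ _ _ _ _ _ _ _ s D a t tl hs hsx hD hsa _ _ => ?_⟩
  have hs0 : 0 < s := hs
  have hD0 : 0 < D := hD
  have hφ : (0 : ℝ) < Nat.totient s := by exact_mod_cast Nat.totient_pos.2 hs0
  -- `(D, s) = 1` from `(s, aD) = 1`
  have hDs : D.Coprime s := by
    have h1 : IsCoprime (s : ℤ) (D : ℤ) := hsa.of_mul_right_right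
    rw [Int.isCoprime_iff_gcd_eq_one, Int.gcd_natCast_natCast] at h1
    exact Nat.Coprime.symm h1
  -- the tuple sum is the one-variable sum
  have hsum : ∑ m ∈ piFinset (fun i => apBox (lo i) (hi i) D (t i)), ∑ n ∈ apBox lol hil D tl,
        gAP s a ((∏ i, m i) * n) = ∑ n ∈ apBox lol hil D tl, gAP s a n := by
    rw [show piFinset (fun i => apBox (lo i) (hi i) D (t i)) = {fun i => Fin.elim0 i} from ?_]
    · rw [Finset.sum_singleton]
      simp
    · ext m
      simp only [Fintype.mem_piFinset, IsEmpty.forall_iff, Finset.mem_singleton, true_iff]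
      funext i; exact Fin.elim0 i
  rw [hsum]
  have key := abs_sum_apBox_gAP_le hs0 hD0 hDs a tl ⌊lol⌋₊ ⌊hil⌋₊
  refine key.trans ?_
  -- `1 + τ/φ ≤ 2 x^{4/5} / φ`
  have hs_le : (s : ℝ) ≤ x ^ (4 / 5 : ℝ) := hsx.trans (Real.rpow_le_rpow_of_exponent_le hx hθ)
  have hφs : (Nat.totient s : ℝ) ≤ s := by exact_mod_cast Nat.totient_le s
  have hτs : (σ 0 s : ℝ) ≤ s := by
    rw [ArithmeticFunction.sigma_zero_apply]
    exact_mod_cast Nat.card_divisors_le_self s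
  rw [Real.rpow_zero, mul_one, show (1 : ℝ) - 1 / 5 = 4 / 5 by norm_num]
  have h1 : 1 + (σ 0 s : ℝ) / (Nat.totient s : ℝ) =
      ((Nat.totient s : ℝ) + σ 0 s) / (Nat.totient s : ℝ) := by
    field_simp
  rw [h1]
  apply div_le_div_of_nonneg_right _ hφ.le
  linarith

end FouvryTenenbaum2021

end Literature.NumberTheory.Sieve

end
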